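import Mathlib
import Literature.NumberTheory.Automorphic.TwistedQuotientConeDescentRows
import Literature.NumberTheory.Transcendental.FormIntegrationCharts
import HarnessLib

/-!
# Twisted pull-backs of differential forms: operator norms, derivatives, invariance, and the
# pull-back along an equivariant scale-invariant retraction

Topic `NumberTheory/Automorphic`; namespace `Literature.NumberTheory.Automorphic`, grouping
sub-namespace `TwistedQuotient` (the vocabulary of `TwistedQuotientConeDescentRows`: for a group `G`
acting on a real normed space `W` through `a : G →* (W →L[ℝ] W)` and on a finite-dimensional complex
space `V` through `ρ`, the twisted pull-back of an alternating `r`-form is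
`actAlt ρ a g r M = ρ(g) ∘ M ∘ ∧ʳ a(g⁻¹)`), and `TwistedQuotient.Pullback` for the pure calculus.
Theorems only; the elementary calculus used in the regularisation of invariant forms on locally
symmetric spaces [Borel1983Regularization, §3]:

* `norm_actAlt_apply_le`, `norm_actAlt_le` — `‖g ⋆ M‖ ≤ ‖ρ g‖ ‖a g⁻¹‖ʳ ‖M‖`;
* `hasFDerivAt_actAlt_comp`, `fderiv_actAlt_comp_apply`, `norm_fderiv_actAlt_comp_le` — the
  derivative of `y ↦ g ⋆ β(a g⁻¹ y)`;
* `fderiv_apply_eq_of_invariant`, `norm_le_of_invariant`, `norm_fderiv_le_of_invariant` — an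
  invariant form has an invariant derivative, with the resulting norm bounds;
* `Pullback.fderiv_comm_of_comp_eq`, `Pullback.fderiv_smul_smul_of_invariant`,
  `Pullback.fderiv_apply_self_eq_zero` — derivatives of a map commuting with a linear map, resp.
  invariant under scalings (it kills the Euler vector);
* `Pullback.norm_fderiv_pullback_le` — the operator norm of the derivative of a pulled-back form
  `x ↦ β(p x) ∘ ∧Dp(x)` from uniform bounds on `Dp, D²p, β, Dβ`;
* `contDiffOn_pullback`, `actAlt_pullback_eq`, `pullback_smul_apply`, `pullback_apply_eq_zero` — the
  pull-back `p^* β` along a smooth self-map `p` of an open set which commutes with the action and is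
  invariant under positive scalings: smooth, invariant when `β` is, scale invariant, killed by the
  Euler vector field.

## References

* A. Borel, *Regularization theorems in Lie algebra cohomology. Applications*, Duke Math. J. 50
  (1983), §3. [Borel1983Regularization]
* R. Bott, L. W. Tu, *Differential Forms in Algebraic Topology*, GTM 82 (1982), §I.1–I.2.
  [BottTu1982Forms]
-/

noncomputable section

open Set Filter
open scoped Topology

namespace Literature.NumberTheory.Automorphic

namespace TwistedQuotient

/-! ### Twisted pull-backs: norms and derivatives -/

section ActAlt

variable {G : Type} [Group G]
  {V : Type} [NormedAddCommGroup V] [NormedSpace ℂ V] [FiniteDimensional ℂ V]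
  {W : Type} [NormedAddCommGroup W] [NormedSpace ℝ W]
  (ρ : Representation ℂ G V) (a : G →* (W →L[ℝ] W))

/-- `‖(g ⋆ M)(v)‖ ≤ ‖ρ g‖ ‖M‖ ∏ (‖a g⁻¹‖ ‖vᵢ‖)`. [folklore] -/
theorem norm_actAlt_apply_le (g : G) (r : ℕ) (M : W [⋀^Fin r]→L[ℝ] V) (v : Fin r → W) :
    ‖actAlt ρ a g r M v‖ ≤ ‖ρCLM ρ g‖ * ‖M‖ * ∏ i, (‖a g⁻¹‖ * ‖v i‖) := by
  rw [actAlt_apply, ← ρCLM_apply, mul_assoc]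
  refine ((ρCLM ρ g).le_opNorm _).trans (mul_le_mul_of_nonneg_left ?_ (norm_nonneg _))
  exact (M.le_opNorm _).trans (mul_le_mul_of_nonneg_left
    (Finset.prod_le_prod (fun i _ => norm_nonneg _) fun i _ => (a g⁻¹).le_opNorm (v i)) (norm_nonneg _))

/-- `‖g ⋆ M‖ ≤ ‖ρ g‖ ‖a g⁻¹‖ʳ ‖M‖`. [folklore] -/
theorem norm_actAlt_le (g : G) (r : ℕ) (M : W [⋀^Fin r]→L[ℝ] V) :
    ‖actAlt ρ a g r M‖ ≤ ‖ρCLM ρ g‖ * ‖a g⁻¹‖ ^ r * ‖M‖ := by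
  refine ContinuousAlternatingMap.opNorm_le_bound _ (by positivity) fun v => ?_
  refine (norm_actAlt_apply_le ρ a g r M v).trans (le_of_eq ?_)
  rw [Finset.prod_mul_distrib, Finset.prod_const, Finset.card_univ, Fintype.card_fin]
  ring

/-- The derivative of the twisted pull-back `y ↦ g ⋆ β(a g⁻¹ y)` (chain rule through the two linear
operations). [folklore] -/
theorem hasFDerivAt_actAlt_comp {r : ℕ} {β : W → W [⋀^Fin r]→L[ℝ] V} (g : G) {x : W}
    {D : W →L[ℝ] W [⋀^Fin r]→L[ℝ] V} (hβ : HasFDerivAt β D (a g⁻¹ x)) :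
    HasFDerivAt (fun y => actAlt ρ a g r (β (a g⁻¹ y)))
      (((ContinuousLinearMap.compContinuousAlternatingMapCLM ℝ W V V (Fin r) (ρCLM ρ g)).comp
        (ContinuousAlternatingMap.compContinuousLinearMapCLM (a g⁻¹))).comp (D.comp (a g⁻¹))) x :=
  ((ContinuousLinearMap.compContinuousAlternatingMapCLM ℝ W V V (Fin r) (ρCLM ρ g)).comp
    (ContinuousAlternatingMap.compContinuousLinearMapCLM (a g⁻¹))).hasFDerivAt.comp x
    (hβ.comp x (a g⁻¹).hasFDerivAt)

/-- The derivative of the twisted pull-back, applied: `D(g ⋆ β ∘ a g⁻¹)(x)(w) = g ⋆ (Dβ(a g⁻¹ x)(a g⁻¹ w))`.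
[folklore] -/
theorem fderiv_actAlt_comp_apply {r : ℕ} {β : W → W [⋀^Fin r]→L[ℝ] V} (g : G) {x : W}
    (hβ : DifferentiableAt ℝ β (a g⁻¹ x)) (w : W) :
    fderiv ℝ (fun y => actAlt ρ a g r (β (a g⁻¹ y))) x w =
      actAlt ρ a g r (fderiv ℝ β (a g⁻¹ x) (a g⁻¹ w)) := by
  rw [(hasFDerivAt_actAlt_comp ρ a g hβ.hasFDerivAt).fderiv]
  rfl

/-- The twisted pull-back is differentiable where `β` is. [folklore] -/
theorem differentiableAt_actAlt_comp {r : ℕ} {β : W → W [⋀^Fin r]→L[ℝ] V} (g : G) {x : W}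
    (hβ : DifferentiableAt ℝ β (a g⁻¹ x)) :
    DifferentiableAt ℝ (fun y => actAlt ρ a g r (β (a g⁻¹ y))) x :=
  (hasFDerivAt_actAlt_comp ρ a g hβ.hasFDerivAt).differentiableAt

/-- **The derivative of an invariant form is invariant**: if `g ⋆ β ∘ a g⁻¹ = β` on an open `X`,
then `Dβ(x)(w) = g ⋆ (Dβ(a g⁻¹ x)(a g⁻¹ w))` at `x ∈ X`. [folklore] -/
theorem fderiv_apply_eq_of_invariant {X : Set W} (hXo : IsOpen X) {r : ℕ}
    {β : W → W [⋀^Fin r]→L[ℝ] V} {g : G}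
    (hinv : ∀ y ∈ X, actAlt ρ a g r (β (a g⁻¹ y)) = β y) {x : W} (hx : x ∈ X)
    (hβ : DifferentiableAt ℝ β (a g⁻¹ x)) (w : W) :
    fderiv ℝ β x w = actAlt ρ a g r (fderiv ℝ β (a g⁻¹ x) (a g⁻¹ w)) := by
  have h : β =ᶠ[𝓝 x] fun y => actAlt ρ a g r (β (a g⁻¹ y)) :=
    Filter.eventually_of_mem (hXo.mem_nhds hx) fun y hy => (hinv y hy).symm
  rw [h.fderiv_eq, fderiv_actAlt_comp_apply ρ a g hβ w]

/-- Norm of an invariant form: `‖β x‖ ≤ ‖ρ g‖ ‖a g⁻¹‖ʳ ‖β (a g⁻¹ x)‖`. [folklore] -/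
theorem norm_le_of_invariant {r : ℕ} {β : W → W [⋀^Fin r]→L[ℝ] V} {g : G} {x : W}
    (h : actAlt ρ a g r (β (a g⁻¹ x)) = β x) :
    ‖β x‖ ≤ ‖ρCLM ρ g‖ * ‖a g⁻¹‖ ^ r * ‖β (a g⁻¹ x)‖ := by
  rw [← h]
  exact norm_actAlt_le ρ a g r _

/-- Norm of the derivative of an invariant form:
`‖Dβ x‖ ≤ ‖ρ g‖ ‖a g⁻¹‖^{r+1} ‖Dβ (a g⁻¹ x)‖`. [folklore] -/
theorem norm_fderiv_le_of_invariant {X : Set W} (hXo : IsOpen X) {r : ℕ}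
    {β : W → W [⋀^Fin r]→L[ℝ] V} {g : G}
    (hinv : ∀ y ∈ X, actAlt ρ a g r (β (a g⁻¹ y)) = β y) {x : W} (hx : x ∈ X)
    (hβ : DifferentiableAt ℝ β (a g⁻¹ x)) :
    ‖fderiv ℝ β x‖ ≤ ‖ρCLM ρ g‖ * ‖a g⁻¹‖ ^ (r + 1) * ‖fderiv ℝ β (a g⁻¹ x)‖ := by
  refine ContinuousLinearMap.opNorm_le_bound _ (by positivity) fun w => ?_
  rw [fderiv_apply_eq_of_invariant ρ a hXo hinv hx hβ w]
  calc ‖actAlt ρ a g r (fderiv ℝ β (a g⁻¹ x) (a g⁻¹ w))‖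
      ≤ ‖ρCLM ρ g‖ * ‖a g⁻¹‖ ^ r * ‖fderiv ℝ β (a g⁻¹ x) (a g⁻¹ w)‖ := norm_actAlt_le ρ a g r _
    _ ≤ ‖ρCLM ρ g‖ * ‖a g⁻¹‖ ^ r * (‖fderiv ℝ β (a g⁻¹ x)‖ * (‖a g⁻¹‖ * ‖w‖)) := by
        gcongr
        exact ((fderiv ℝ β (a g⁻¹ x)).le_opNorm _).trans
          (mul_le_mul_of_nonneg_left ((a g⁻¹).le_opNorm w) (norm_nonneg _))
    _ = ‖ρCLM ρ g‖ * ‖a g⁻¹‖ ^ (r + 1) * ‖fderiv ℝ β (a g⁻¹ x)‖ * ‖w‖ := by ring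

/-- Norm of the derivative of a twisted pull-back:
`‖D(g ⋆ β ∘ a g⁻¹)(x)‖ ≤ ‖ρ g‖ ‖a g⁻¹‖^{r+1} ‖Dβ(a g⁻¹ x)‖`. [folklore] -/
theorem norm_fderiv_actAlt_comp_le {r : ℕ} {β : W → W [⋀^Fin r]→L[ℝ] V} (g : G) {x : W}
    (hβ : DifferentiableAt ℝ β (a g⁻¹ x)) :
    ‖fderiv ℝ (fun y => actAlt ρ a g r (β (a g⁻¹ y))) x‖ ≤
      ‖ρCLM ρ g‖ * ‖a g⁻¹‖ ^ (r + 1) * ‖fderiv ℝ β (a g⁻¹ x)‖ := by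
  refine ContinuousLinearMap.opNorm_le_bound _ (by positivity) fun w => ?_
  rw [fderiv_actAlt_comp_apply ρ a g hβ w]
  calc ‖actAlt ρ a g r (fderiv ℝ β (a g⁻¹ x) (a g⁻¹ w))‖
      ≤ ‖ρCLM ρ g‖ * ‖a g⁻¹‖ ^ r * ‖fderiv ℝ β (a g⁻¹ x) (a g⁻¹ w)‖ := norm_actAlt_le ρ a g r _
    _ ≤ ‖ρCLM ρ g‖ * ‖a g⁻¹‖ ^ r * (‖fderiv ℝ β (a g⁻¹ x)‖ * (‖a g⁻¹‖ * ‖w‖)) := by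
        gcongr
        exact ((fderiv ℝ β (a g⁻¹ x)).le_opNorm _).trans
          (mul_le_mul_of_nonneg_left ((a g⁻¹).le_opNorm w) (norm_nonneg _))
    _ = ‖ρCLM ρ g‖ * ‖a g⁻¹‖ ^ (r + 1) * ‖fderiv ℝ β (a g⁻¹ x)‖ * ‖w‖ := by ring

end ActAlt

/-! ### Commuting with a linear map, scalings, and the derivative of a pulled-back form -/

namespace Pullback

variable {W : Type*} [NormedAddCommGroup W] [NormedSpace ℝ W]

/-- If `p ∘ A = A ∘ p` on an open `A`-stable set `X` and `p` is differentiable on `X`, then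
`Dp(A x)(A w) = A (Dp(x) w)` at `x ∈ X`. [folklore] -/
theorem fderiv_comm_of_comp_eq {X : Set W} (hXo : IsOpen X) (A : W →L[ℝ] W) (hA : MapsTo A X X)
    {p : W → W} (hp : DifferentiableOn ℝ p X) (hcomm : ∀ y ∈ X, p (A y) = A (p y)) {x : W}
    (hx : x ∈ X) (w : W) : fderiv ℝ p (A x) (A w) = A (fderiv ℝ p x w) := by
  have h1 : (fun y => p (A y)) =ᶠ[𝓝 x] fun y => A (p y) :=
    Filter.eventually_of_mem (hXo.mem_nhds hx) fun y hy => hcomm y hy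
  have hpx : DifferentiableAt ℝ p x := (hp x hx).differentiableAt (hXo.mem_nhds hx)
  have hpAx : DifferentiableAt ℝ p (A x) := (hp _ (hA hx)).differentiableAt (hXo.mem_nhds (hA hx))
  have h2 : fderiv ℝ (fun y => p (A y)) x = (fderiv ℝ p (A x)).comp A :=
    (hpAx.hasFDerivAt.comp x A.hasFDerivAt).fderiv
  have h3 : fderiv ℝ (fun y => A (p y)) x = A.comp (fderiv ℝ p x) :=
    (A.hasFDerivAt.comp x hpx.hasFDerivAt).fderiv
  have h := h1.fderiv_eq (𝕜 := ℝ)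
  rw [h2, h3] at h
  exact congrArg (fun L : W →L[ℝ] W => L w) h

/-- If `p (r • y) = p y` on an open set `X` stable under the positive scaling `r`, then
`Dp(r x)(r w) = Dp(x) w` at `x ∈ X`. [folklore] -/
theorem fderiv_smul_smul_of_invariant {X : Set W} (hXo : IsOpen X) {r : ℝ}
    (hr : ∀ y ∈ X, r • y ∈ X) {p : W → W} (hp : DifferentiableOn ℝ p X)
    (hinv : ∀ y ∈ X, p (r • y) = p y) {x : W} (hx : x ∈ X) (w : W) :
    fderiv ℝ p (r • x) (r • w) = fderiv ℝ p x w := by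
  have h1 : (fun y => p (r • y)) =ᶠ[𝓝 x] p :=
    Filter.eventually_of_mem (hXo.mem_nhds hx) fun y hy => hinv y hy
  have hpAx : DifferentiableAt ℝ p (r • x) := (hp _ (hr x hx)).differentiableAt (hXo.mem_nhds (hr x hx))
  have h2 : fderiv ℝ (fun y => p (r • y)) x = (fderiv ℝ p (r • x)).comp (r • ContinuousLinearMap.id ℝ W) :=
    (hpAx.hasFDerivAt.comp x ((ContinuousLinearMap.id ℝ W).hasFDerivAt.const_smul r)).fderiv
  have h := h1.fderiv_eq (𝕜 := ℝ)
  rw [h2] at h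
  simpa using congrArg (fun L : W →L[ℝ] W => L w) h

/-- **A scale-invariant map kills the Euler vector**: if `p (r • y) = p y` for all `r > 0` on an open
cone `X`, then `Dp(x) x = 0` at `x ∈ X` (differentiate `t ↦ p((1 + t) x)` at `t = 0`). [folklore] -/
theorem fderiv_apply_self_eq_zero {X : Set W} (hXo : IsOpen X)
    {p : W → W} (hp : DifferentiableOn ℝ p X)
    (hinv : ∀ r : ℝ, 0 < r → ∀ y ∈ X, p (r • y) = p y) {x : W} (hx : x ∈ X) :
    fderiv ℝ p x x = 0 := by
  have hpx : DifferentiableAt ℝ p x := (hp x hx).differentiableAt (hXo.mem_nhds hx)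
  -- the curve `t ↦ p ((1 + t) • x)` has derivative `Dp(x) x` at `0` ...
  have hc : HasDerivAt (fun t : ℝ => (1 + t) • x) x 0 := by
    simpa using ((hasDerivAt_id (0 : ℝ)).const_add 1).smul_const x
  have h1 : HasDerivAt (fun t : ℝ => p ((1 + t) • x)) (fderiv ℝ p x x) 0 := by
    have hpx' : HasFDerivAt p (fderiv ℝ p x) ((1 + (0 : ℝ)) • x) := by simpa using hpx.hasFDerivAt
    exact hpx'.comp_hasDerivAt (0 : ℝ) hc
  -- ... and is constant near `0`
  have h2 : HasDerivAt (fun t : ℝ => p ((1 + t) • x)) 0 0 := by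
    refine (hasDerivAt_const (0 : ℝ) (p x)).congr_of_eventuallyEq ?_
    have hI : Set.Ioi (-1 : ℝ) ∈ 𝓝 (0 : ℝ) := Ioi_mem_nhds (by norm_num)
    filter_upwards [hI] with t ht
    exact hinv (1 + t) (by simp only [Set.mem_Ioi] at ht; linarith) x hx
  exact h1.unique h2

/-- **Operator norm of the derivative of a pulled-back form** `x ↦ β₀(p x) ∘ ∧Dp(x)` at `y`, from
uniform bounds `M ≥ 1` on `‖Dp y‖, ‖D²p y‖, ‖β₀ (p y)‖, ‖Dβ₀ (p y)‖`: it is `≤ (1 + q) M^{q+2}` (Leibniz rule,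
evaluated on unit vectors). [folklore] -/
theorem norm_fderiv_pullback_le {V : Type} [NormedAddCommGroup V] [NormedSpace ℝ V] {q : ℕ}
    {β₀ : W → (W [⋀^Fin q]→L[ℝ] V)} {p : W → W} {y : W} {M : ℝ}
    (hβ₀ : DifferentiableAt ℝ β₀ (p y)) (hp : DifferentiableAt ℝ p y)
    (hp2 : DifferentiableAt ℝ (fun x => fderiv ℝ p x) y) (hM : 1 ≤ M)
    (h1 : ‖fderiv ℝ p y‖ ≤ M) (h2 : ‖fderiv ℝ (fun x => fderiv ℝ p x) y‖ ≤ M)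
    (h3 : ‖β₀ (p y)‖ ≤ M) (h4 : ‖fderiv ℝ β₀ (p y)‖ ≤ M) :
    ‖fderiv ℝ (fun x => (β₀ (p x)).compContinuousLinearMap (fderiv ℝ p x)) y‖ ≤ (1 + q) * M ^ (q + 2) := by
  classical
  have hM0 : 0 ≤ M := zero_le_one.trans hM
  have hf : DifferentiableAt ℝ (fun x => β₀ (p x)) y := hβ₀.comp y hp
  rw [(hf.hasFDerivAt.continuousAlternatingMapCompContinuousLinearMap hp2.hasFDerivAt).fderiv]
  refine ContinuousLinearMap.opNorm_le_of_unit_norm (by positivity) fun w hw => ?_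
  refine ContinuousAlternatingMap.opNorm_le_bound _ (by positivity) fun v => ?_
  rw [_root_.add_apply, ContinuousLinearMap.comp_apply, ContinuousLinearMap.comp_apply,
    ContinuousAlternatingMap.add_apply, ContinuousAlternatingMap.compContinuousLinearMapCLM_apply,
    ContinuousAlternatingMap.compContinuousLinearMap_apply,
    ContinuousAlternatingMap.fderivCompContinuousLinearMap_apply]
  have hP : 0 ≤ ∏ j, ‖v j‖ := Finset.prod_nonneg fun j _ => norm_nonneg _
  have hprod : ∀ L : Fin q → W →L[ℝ] W, (∀ j, ‖L j‖ ≤ M) → ∏ j, ‖L j (v j)‖ ≤ M ^ q * ∏ j, ‖v j‖ := by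
    intro L hL
    calc ∏ j, ‖L j (v j)‖ ≤ ∏ j, (M * ‖v j‖) :=
          Finset.prod_le_prod (fun j _ => norm_nonneg _) fun j _ =>
            ((L j).le_opNorm _).trans (mul_le_mul_of_nonneg_right (hL j) (norm_nonneg _))
      _ = M ^ q * ∏ j, ‖v j‖ := by
          rw [Finset.prod_mul_distrib, Finset.prod_const, Finset.card_univ, Fintype.card_fin]
  have hA : ‖(fderiv ℝ (fun x => β₀ (p x)) y w) (⇑(fderiv ℝ p y) ∘ v)‖ ≤ M ^ (q + 2) * ∏ j, ‖v j‖ := by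
    have hc : fderiv ℝ (fun x => β₀ (p x)) y = (fderiv ℝ β₀ (p y)).comp (fderiv ℝ p y) :=
      (hβ₀.hasFDerivAt.comp y hp.hasFDerivAt).fderiv
    rw [hc, ContinuousLinearMap.comp_apply]
    calc ‖fderiv ℝ β₀ (p y) (fderiv ℝ p y w) (⇑(fderiv ℝ p y) ∘ v)‖
        ≤ ‖fderiv ℝ β₀ (p y) (fderiv ℝ p y w)‖ * ∏ j, ‖(⇑(fderiv ℝ p y) ∘ v) j‖ :=
          ContinuousAlternatingMap.le_opNorm _ _
      _ ≤ (M * M) * (M ^ q * ∏ j, ‖v j‖) := by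
          refine mul_le_mul ?_ (hprod (fun _ => fderiv ℝ p y) fun _ => h1) (by positivity) (by positivity)
          calc ‖fderiv ℝ β₀ (p y) (fderiv ℝ p y w)‖ ≤ ‖fderiv ℝ β₀ (p y)‖ * ‖fderiv ℝ p y w‖ :=
                ContinuousLinearMap.le_opNorm _ _
            _ ≤ M * (M * ‖w‖) :=
                mul_le_mul h4 (((fderiv ℝ p y).le_opNorm w).trans (mul_le_mul_of_nonneg_right h1 (norm_nonneg _)))
                  (norm_nonneg _) hM0
            _ = M * M := by rw [hw, mul_one]
      _ = M ^ (q + 2) * ∏ j, ‖v j‖ := by ring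
  have hB : ‖∑ i : Fin q, β₀ (p y) (fun j => Function.update (fun _ => fderiv ℝ p y) i
      (fderiv ℝ (fun x => fderiv ℝ p x) y w) j (v j))‖ ≤ q * M ^ (q + 1) * ∏ j, ‖v j‖ := by
    calc ‖∑ i : Fin q, β₀ (p y) (fun j => Function.update (fun _ => fderiv ℝ p y) i
          (fderiv ℝ (fun x => fderiv ℝ p x) y w) j (v j))‖
        ≤ ∑ i : Fin q, ‖β₀ (p y) (fun j => Function.update (fun _ => fderiv ℝ p y) i
            (fderiv ℝ (fun x => fderiv ℝ p x) y w) j (v j))‖ := norm_sum_le _ _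
      _ ≤ ∑ _i : Fin q, M ^ (q + 1) * ∏ j, ‖v j‖ := by
          refine Finset.sum_le_sum fun i _ => ?_
          calc ‖β₀ (p y) (fun j => Function.update (fun _ => fderiv ℝ p y) i
                (fderiv ℝ (fun x => fderiv ℝ p x) y w) j (v j))‖
              ≤ ‖β₀ (p y)‖ * ∏ j, ‖Function.update (fun _ => fderiv ℝ p y) i
                  (fderiv ℝ (fun x => fderiv ℝ p x) y w) j (v j)‖ := ContinuousAlternatingMap.le_opNorm _ _
            _ ≤ M * (M ^ q * ∏ j, ‖v j‖) := by
                refine mul_le_mul h3 (hprod _ fun j => ?_) (by positivity) hM0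
                rcases eq_or_ne j i with rfl | hji
                · rw [Function.update_self]
                  calc ‖fderiv ℝ (fun x => fderiv ℝ p x) y w‖ ≤ ‖fderiv ℝ (fun x => fderiv ℝ p x) y‖ * ‖w‖ :=
                        ContinuousLinearMap.le_opNorm _ _
                    _ ≤ M := by rw [hw, mul_one]; exact h2
                · rw [Function.update_of_ne hji]
                  exact h1
            _ = M ^ (q + 1) * ∏ j, ‖v j‖ := by ring
      _ = q * M ^ (q + 1) * ∏ j, ‖v j‖ := by
          rw [Finset.sum_const, Finset.card_univ, Fintype.card_fin, nsmul_eq_mul]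
          ring
  have hpow : M ^ (q + 1) ≤ M ^ (q + 2) := pow_le_pow_right₀ hM (by omega)
  calc _ ≤ ‖(fderiv ℝ (fun x => β₀ (p x)) y w) (⇑(fderiv ℝ p y) ∘ v)‖ +
        ‖∑ i : Fin q, β₀ (p y) (fun j => Function.update (fun _ => fderiv ℝ p y) i
          (fderiv ℝ (fun x => fderiv ℝ p x) y w) j (v j))‖ := norm_add_le _ _
    _ ≤ M ^ (q + 2) * ∏ j, ‖v j‖ + q * M ^ (q + 1) * ∏ j, ‖v j‖ := add_le_add hA hB
    _ ≤ (1 + q) * M ^ (q + 2) * ∏ i, ‖v i‖ := by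
        have hq : (0 : ℝ) ≤ q := Nat.cast_nonneg q
        nlinarith [mul_le_mul_of_nonneg_right hpow hP, mul_nonneg hq (mul_nonneg (sub_nonneg.2 hpow) hP)]

end Pullback

/-! ### The pull-back along an equivariant scale-invariant map -/

section Retraction

variable {G : Type} [Group G]
  {V : Type} [NormedAddCommGroup V] [NormedSpace ℂ V] [FiniteDimensional ℂ V]
  {W : Type} [NormedAddCommGroup W] [NormedSpace ℝ W]

omit [FiniteDimensional ℂ V] in
/-- **The pull-back `p^* β` of a `C^∞` form along a `C^∞` self-map of an open set is `C^∞`**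
(composition, the derivative of `p`, and the smoothness of `(M, L) ↦ M ∘ ∧L`). [folklore] -/
theorem contDiffOn_pullback {X : Set W} (hXo : IsOpen X) {p : W → W}
    (hp : ContDiffOn ℝ ((⊤ : ℕ∞) : WithTop ℕ∞) p X) (hpX : MapsTo p X X) {r : ℕ}
    {β : W → W [⋀^Fin r]→L[ℝ] V} (hβ : ContDiffOn ℝ ((⊤ : ℕ∞) : WithTop ℕ∞) β X) :
    ContDiffOn ℝ ((⊤ : ℕ∞) : WithTop ℕ∞) (fun x => (β (p x)).compContinuousLinearMap (fderiv ℝ p x)) X := by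
  have h1 : ContDiffOn ℝ ((⊤ : ℕ∞) : WithTop ℕ∞) (fun x => β (p x)) X := hβ.comp hp hpX
  have h2 : ContDiffOn ℝ ((⊤ : ℕ∞) : WithTop ℕ∞) (fun x => fderiv ℝ p x) X :=
    ((contDiffOn_infty_iff_fderiv_of_isOpen hXo).1 hp).2
  intro x hx
  exact Literature.NumberTheory.Transcendental.ContDiffWithinAt.continuousAlternatingMapCompContinuousLinearMap
    (h1 x hx) (h2 x hx)

/-- **The pull-back of an invariant form along an equivariant map is invariant**: if `p` commutes
with `a g⁻¹` on the open `G`-stable set `X` and `g ⋆ β ∘ a g⁻¹ = β` on `X`, then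
`g ⋆ (p^* β) ∘ a g⁻¹ = p^* β` at the points of `X`. [folklore] -/
theorem actAlt_pullback_eq (ρ : Representation ℂ G V) (a : G →* (W →L[ℝ] W)) {X : Set W}
    (hXo : IsOpen X) (hmaps : ∀ g : G, MapsTo (a g) X X) {p : W → W} (hpX : MapsTo p X X)
    (hpd : DifferentiableOn ℝ p X) (g : G) (hpg : ∀ y ∈ X, p (a g⁻¹ y) = a g⁻¹ (p y)) {r : ℕ}
    {β : W → W [⋀^Fin r]→L[ℝ] V} (hβ : ∀ y ∈ X, actAlt ρ a g r (β (a g⁻¹ y)) = β y) {x : W}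
    (hx : x ∈ X) :
    actAlt ρ a g r ((β (p (a g⁻¹ x))).compContinuousLinearMap (fderiv ℝ p (a g⁻¹ x))) =
      (β (p x)).compContinuousLinearMap (fderiv ℝ p x) := by
  ext v
  have key := congrArg (fun M => M (fun i => fderiv ℝ p x (v i))) (hβ (p x) (hpX hx))
  simp only [actAlt_apply] at key
  rw [actAlt_apply]
  simp only [ContinuousAlternatingMap.compContinuousLinearMap_apply, Function.comp_def]
  rw [← key, hpg x hx]
  simp only [Pullback.fderiv_comm_of_comp_eq hXo (a g⁻¹) (hmaps g⁻¹) hpd hpg hx]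

omit [FiniteDimensional ℂ V] in
/-- **The pull-back along a scale-invariant map is scale invariant**:
`(p^* β)(c x)(c v₁, …) = (p^* β)(x)(v₁, …)` for `c > 0` on an open cone `X`. [folklore] -/
theorem pullback_smul_apply {X : Set W} (hXo : IsOpen X) (hXc : ∀ r : ℝ, 0 < r → ∀ y ∈ X, r • y ∈ X)
    {p : W → W} (hpd : DifferentiableOn ℝ p X) (hps : ∀ r : ℝ, 0 < r → ∀ y ∈ X, p (r • y) = p y)
    {r : ℕ} (β : W → W [⋀^Fin r]→L[ℝ] V) {c : ℝ} (hc : 0 < c) {x : W} (hx : x ∈ X) (v : Fin r → W) :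
    (β (p (c • x))).compContinuousLinearMap (fderiv ℝ p (c • x)) (fun i => c • v i) =
      (β (p x)).compContinuousLinearMap (fderiv ℝ p x) v := by
  simp only [ContinuousAlternatingMap.compContinuousLinearMap_apply, Function.comp_def]
  rw [hps c hc x hx]
  simp only [Pullback.fderiv_smul_smul_of_invariant hXo (hXc c hc) hpd (hps c hc) hx]

omit [FiniteDimensional ℂ V] in
/-- **The pull-back along a scale-invariant map is killed by the Euler vector field**:
`(p^* β)(x)(v₁, …) = 0` as soon as some `vᵢ = x` (`Dp(x) x = 0`). [folklore] -/
theorem pullback_apply_eq_zero {X : Set W} (hXo : IsOpen X) {p : W → W} (hpd : DifferentiableOn ℝ p X)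
    (hps : ∀ r : ℝ, 0 < r → ∀ y ∈ X, p (r • y) = p y) {r : ℕ} (β : W → W [⋀^Fin r]→L[ℝ] V)
    {x : W} (hx : x ∈ X) {v : Fin r → W} {i : Fin r} (hi : v i = x) :
    (β (p x)).compContinuousLinearMap (fderiv ℝ p x) v = 0 := by
  rw [ContinuousAlternatingMap.compContinuousLinearMap_apply]
  refine ContinuousAlternatingMap.map_coord_zero _ i ?_
  rw [Function.comp_apply, hi]
  exact Pullback.fderiv_apply_self_eq_zero hXo hpd hps hx

end Retraction

end TwistedQuotient

end Literature.NumberTheory.Automorphic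

end
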